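import Summits.BirchSwinnertonDyer.BirchSwinnertonDyer.Theorems.Rank2Observatory2DescClRealKillCertE2Defs
import Summits.BirchSwinnertonDyer.BirchSwinnertonDyer.Theorems.Rank2Observatory2DescClKillCurveCertE2
import HarnessLib

/-!
# BirchSwinnertonDyer — rank ≥ 2 observatory: KERNEL-2DESC-CL v2.7 — TWO-VIEW certificates WITH A KILL LIST (totally real case), part 2/3: soundness

HONEST FRAMING: per-curve certified theorems and census instruments; no claim on BSD in rank ≥ 2.

**Soundness of `checkE2RK`** (`rank_le_of_checkE2RK`): the proof of the v2.3 theorem `rank_le_of_checkE2R` VERBATIM up to its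
last step (three-place archimedean sieve `admR2` sound for every class met by a rational point), then the kill step of the complex
file `…ClKillCurveCertE2` read on `G.toE2`, `ccr.cc`: rescaling by the square `m₁^(#U+1) = (r₁^(#U+1))²` turns the class relation into
`(m₁x − X_t(θ))·∏_{j∈U} X_j(θ) ∈ (K×)²`, excluded for every listed class by the landed `admKills_sound` given the list certificate
(`killListCheck_of_searchE2`); the strict-count cover theorem `mordellWeilRank_le_of_coverSet_cl_lt` gives `rank E(ℚ) ≤ r`.
Then `rank_eq_of_checkE2RK`.  Row shapes: part 3.  Sorry-free; new declarations only.
[cite: Cassels1991LecturesEllipticCurves, §15] [cite: CremonaAlgorithms1997, §3.6] [cite: Cohen1993, §4.8.2, §6.2, §6.5]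
[cite: Marcus2018, Ch. 5, Thm. 38] [cite: SilvermanAEC2009, X.1.1]
-/

set_option linter.dupNamespace false

noncomputable section

open Polynomial NumberField IsDedekindDomain Module
open Literature.NumberTheory.NumberFields   -- OPENFIX (cert-1 gen 35): `MonicCubic.*` lives in this namespace; the line was missing (inlined-head prechecks leaked it from `…ClRealCertE`)

namespace Summit.BirchSwinnertonDyer.BirchSwinnertonDyer.Rank2Observatory.TwoDescCl

open TwoDescCubic ClFieldCert

section Sound

variable {K : Type*} [Field K] [NumberField K] {θ : K} {F : ClFieldCertE2}
variable {G : ClFieldCertRE2} {ccr : ClCurveCertE2R} {f : FamEntry2}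

/-- **Soundness of the totally real two-view per-curve checker with a kill list: `rank E(ℚ) ≤ r`.**
[cite: Cassels1991LecturesEllipticCurves, §15] [cite: CremonaAlgorithms1997, §3.6] -/
theorem rank_le_of_checkE2RK (r : ℕ) (G : ClFieldCertRE2)
    (hθ : aeval θ (MonicCubic.poly G.toE2.fe.base.a G.toE2.fe.base.b G.toE2.fe.base.c) = 0)
    (h3 : finrank ℚ K = 3) (h2 : G.check2R = true) (hpr : G.toE2.fe.primeListE.Forall Nat.Prime)
    (ccr : ClCurveCertE2R) (ks : List ClKillE2) (hc : checkE2RK G ccr r ks = true)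
    (hk : killSearchE2 G.toE2 ccr.cc ks = true) :
    ((⟨0, ccr.cc.A, 0, ccr.cc.B, ccr.cc.C⟩ : WeierstrassCurve ℚ)).mordellWeilRank ≤ r := by
  classical
  have hK := G.const_of_check2R h2
  have harch := G.checkArch_of_check2R h2
  have hE := G.checkCoreE_of_check2R h2
  have hR := G.toE2.fe.checkReg_of_coreE hE
  have hprb := G.toE2.fe.base_primeList hpr
  have hirr := G.toE2.fe.base.irreducible_of_reg hR
  have h0 := G.fre.re.lo_nonneg_of_arch harch
  have hq := G.toE2.fe.base.q_prime hprb
  simp only [checkE2RK, Bool.and_eq_true, decide_eq_true_eq, List.all_eq_true] at hc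
  obtain ⟨⟨⟨⟨⟨⟨⟨⟨⟨⟨⟨⟨⟨⟨⟨⟨⟨⟨⟨hΔ, hirrF⟩, hcub⟩, hder⟩, htvX⟩, htvD⟩, hdisc⟩, hND0⟩, hdn⟩, hdnC⟩, hcodes⟩, hdW1⟩,
    hdW2⟩, hQ⟩, hhead⟩, hfamAll⟩, hord⟩, hcert⟩, hlite⟩, hcount⟩ := hc
  haveI hEl := isElliptic_of_deltaShort_ne hΔ
  have hirrF' := irreducible_of_noRootMod hirrF
  have hm₁K : (G.toE2.m₁ : K) ≠ 0 := m₁_ne_zero_K hK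
  have hm₁O : (G.toE2.m₁ : 𝓞 K) ≠ 0 := m₁_ne_zero_O hK
  -- `θ_E = e₀`, root of `F`
  have hXe := m₁_mul_eltOf_coe hθ hE hK htvX
  have haevX := aeval_lin_eq_zero_of_coords hθ ccr.cc.Xt hcub
  have haev : aeval (algebraMap (𝓞 K) K (eltOf G.toE2 hθ hE ccr.cc.Xt ccr.cc.Yt)) (MonicCubic.poly ccr.cc.A ccr.cc.B ccr.cc.C) = 0 := by
    rw [← hXe] at haevX
    simp only [MonicCubic.poly, map_add, map_mul, map_pow, aeval_X, eq_intCast, map_intCast, map_natCast]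
      at haevX ⊢
    have h3' : (G.toE2.m₁ : K) ^ 3 ≠ 0 := pow_ne_zero 3 hm₁K
    apply mul_right_injective₀ h3'
    simp only [mul_zero]
    linear_combination haevX
  -- `D₀ = F′(e₀)`
  have hderX := deriv_eq_of_coords hθ ccr.cc.Xt (smulCoords (G.toE2.m₁ : ℤ) ccr.cc.XD) [] hder
  have hderiv : (3 : 𝓞 K) * (eltOf G.toE2 hθ hE ccr.cc.Xt ccr.cc.Yt) ^ 2 +
      2 * ((ccr.cc.A : ℤ) : 𝓞 K) * (eltOf G.toE2 hθ hE ccr.cc.Xt ccr.cc.Yt) + ((ccr.cc.B : ℤ) : 𝓞 K) = eltOf G.toE2 hθ hE ccr.cc.XD ccr.cc.YD := by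
    rw [lin_smulCoords, ← m₁_mul_eltOf hθ hE hK htvX, ← m₁_mul_eltOf hθ hE hK htvD] at hderX
    simp only [List.map_nil, List.prod_nil, mul_one, Int.cast_mul, Int.cast_pow, Int.cast_natCast] at hderX
    have h2' : (G.toE2.m₁ : 𝓞 K) ^ 2 ≠ 0 := pow_ne_zero 2 hm₁O
    apply mul_right_injective₀ h2'
    simp only
    linear_combination hderX
  have hD0 : eltOf G.toE2 hθ hE ccr.cc.XD ccr.cc.YD ≠ 0 := eltOf_ne_zero hθ h3 hE hK htvD hND0
  have hq0 : ((G.toE2.fe.base.q : ℕ) : 𝓞 K) ≠ 0 := by exact_mod_cast hq.ne_zero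
  have hM0 : eltOf G.toE2 hθ hE ccr.cc.XD ccr.cc.YD * ((G.toE2.fe.base.q : ℕ) : 𝓞 K) ≠ 0 := mul_ne_zero hD0 hq0
  have hgen := closure_tsupp_eq_top_of_dvd
    (dvd_mul_left ((G.toE2.fe.base.q : ℕ) : 𝓞 K) (eltOf G.toE2 hθ hE ccr.cc.XD ccr.cc.YD)) (G.toE2.fe.closure_q_eq_top_of_coreE hθ h3 hE hpr)
  have hDM : ∀ v : HeightOneSpectrum (𝓞 K), (3 : 𝓞 K) * (eltOf G.toE2 hθ hE ccr.cc.Xt ccr.cc.Yt) ^ 2 +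
      2 * ((ccr.cc.A : ℤ) : 𝓞 K) * (eltOf G.toE2 hθ hE ccr.cc.Xt ccr.cc.Yt) + ((ccr.cc.B : ℤ) : 𝓞 K) ∈ v.asIdeal →
      eltOf G.toE2 hθ hE ccr.cc.XD ccr.cc.YD * ((G.toE2.fe.base.q : ℕ) : 𝓞 K) ∈ v.asIdeal := by
    intro v hv
    rw [hderiv] at hv
    exact Ideal.mul_mem_right _ _ hv
  -- `D₀ ∉ W₁, W₂` (read on `X_D`)
  have hXD_W₁ : lin hθ ccr.cc.XD.1 ccr.cc.XD.2.1 ccr.cc.XD.2.2 ∉ (G.toE2.fe.base.W₁r hθ h3 hR hprb).asIdeal :=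
    lin_not_mem_of_invCert hθ _ (W₁r_asIdeal hθ h3 hR hprb) hdW1
  have hXD_W₂ : lin hθ ccr.cc.XD.1 ccr.cc.XD.2.1 ccr.cc.XD.2.2 ∉ (G.toE2.fe.base.W₂r hθ h3 hR hprb).asIdeal :=
    lin_not_mem_of_invCert hθ _ (W₂r_asIdeal hθ h3 hR hprb) hdW2
  have hDW₁ : eltOf G.toE2 hθ hE ccr.cc.XD ccr.cc.YD ∉ (G.toE2.fe.base.W₁r hθ h3 hR hprb).asIdeal := fun h =>
    hXD_W₁ (by rw [← m₁_mul_eltOf hθ hE hK htvD]; exact Ideal.mul_mem_left _ _ h)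
  have hDW₂ : eltOf G.toE2 hθ hE ccr.cc.XD ccr.cc.YD ∉ (G.toE2.fe.base.W₂r hθ h3 hR hprb).asIdeal := fun h =>
    hXD_W₂ (by rw [← m₁_mul_eltOf hθ hE hK htvD]; exact Ideal.mul_mem_left _ _ h)
  -- the support `T = {W₁, W₂} ∪ code primes`
  set L := ccr.cc.codes.length with hL
  let Tf : Fin (L + 2) → HeightOneSpectrum (𝓞 K) := Matrix.vecCons (G.toE2.fe.base.W₁r hθ h3 hR hprb)
    (Matrix.vecCons (G.toE2.fe.base.W₂r hθ h3 hR hprb) fun i => codePrime2 G.toE2 hθ h3 hE hpr (ccr.cc.codes.get i))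
  have hT : ∀ w : HeightOneSpectrum (𝓞 K),
      eltOf G.toE2 hθ hE ccr.cc.XD ccr.cc.YD * ((G.toE2.fe.base.q : ℕ) : 𝓞 K) ∈ w.asIdeal → ∃ i, Tf i = w := by
    intro w hw
    have hqw : ((G.toE2.fe.base.q : ℕ) : 𝓞 K) ∈ w.asIdeal → ∃ i, Tf i = w := fun hqw => by
      rcases eq_W₁r_or_W₂r hθ h3 hR hprb w hqw with rfl | rfl
      · exact ⟨0, by simp [Tf]⟩
      · exact ⟨1, by simp [Tf]⟩
    rcases w.isPrime.mem_or_mem hw with hD | hq'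
    · obtain ⟨hXv, hYv⟩ := avatars_mem hθ hE hK htvD w hD
      obtain ⟨pe, hpe, hpv⟩ := exists_prime_of_mem hθ h3 hE hND0 hdn w hXv
      rcases dispatch_sound (cc := ccr.cc) hθ h3 hE hK hpr (hdnC pe hpe) w hpv hXv hYv with
        hq'' | ⟨C, hmem, hany, hC, hw', -⟩ | ⟨C, hmem, hany, hC, hw', -⟩
      · exact hqw hq''
      · obtain ⟨bc, hbc, hbc1⟩ := List.mem_map.mp hmem
        obtain ⟨i, hi⟩ := List.mem_iff_get.mp hbc
        refine ⟨i.succ.succ, HeightOneSpectrum.ext ?_⟩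
        simp only [Tf, Matrix.cons_val_succ]
        rw [hi, codePrime2, if_pos (by rw [hbc1]), show bc.1.2 = C by rw [hbc1],
          codePrimeR_asIdeal hθ h3 hR hprb hany hC, hw']
      · obtain ⟨bc, hbc, hbc1⟩ := List.mem_map.mp hmem
        obtain ⟨i, hi⟩ := List.mem_iff_get.mp hbc
        refine ⟨i.succ.succ, HeightOneSpectrum.ext ?_⟩
        simp only [Tf, Matrix.cons_val_succ]
        rw [hi, codePrime2, if_neg (by rw [hbc1]; exact Bool.false_ne_true), show bc.1.2 = C by rw [hbc1],
          ClFieldCertE.codePrimeEta_asIdeal hθ h3 hE hpr hany hC, hw']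
    · exact hqw hq'
  -- the family
  set fm := fam2 ccr.cc with hfm
  let W : Fin fm.length → 𝓞 K := fun j => eltOf G.toE2 hθ hE (fm.get j).X (fm.get j).Y
  have hfam : ∀ j : Fin fm.length, famCheckE2R G ccr (fm.get j) = true := fun j => hfamAll _ (List.get_mem _ j)
  have hfam1 : ∀ j : Fin fm.length, famCheckE2 G.toE2 ccr.cc (fm.get j) = true :=
    fun j => famCheckE2_of_famCheckE2R (hfam j)
  have hW0 : ∀ j, W j ≠ 0 := fun j =>
    eltOf_ne_zero hθ h3 hE hK (tv_of_famCheckE2 (hfam1 j)) (normFormZ_ne_of_famCheckE2 (hfam1 j))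
  have hWval : ∀ j (v : HeightOneSpectrum (𝓞 K)),
      eltOf G.toE2 hθ hE ccr.cc.XD ccr.cc.YD * ((G.toE2.fe.base.q : ℕ) : 𝓞 K) ∉ v.asIdeal →
        v.valuation K (algebraMap (𝓞 K) K (W j)) = 1 :=
    fun j v hv => valuation_eq_one_of_support _ _ (supp_of_famCheckE2 hθ h3 hE hK hpr hcodes htvD (hfam1 j)) v hv
  obtain ⟨ρ, hρ⟩ := G.fre.re.exists_rho_of_arch hθ h3 hR harch
  have hsg : ∀ (k : Fin 3) (j : Fin fm.length),
      (sgAt2 ccr (fm.get j) k = true ↔ ρ k (algebraMap (𝓞 K) K (W j)) < 0) :=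
    fun k j => sgAt2_iff_of_famCheckE2R hθ ρ h0 hρ hE hK (hfam j) k
  have hρ0 : ∀ (k : Fin 3) (j : Fin fm.length), ρ k (algebraMap (𝓞 K) K (W j)) ≠ 0 :=
    fun k j => rho_ne_zero_of_famCheckE2R hθ ρ h0 hρ hE hK (hfam j) k
  -- independence modulo squares: the parity certificate (rows computed on `X = m₁ x`, `m₁` a square)
  have hind : ∀ S : Finset (Fin fm.length), IsSquare (∏ i ∈ S, algebraMap (𝓞 K) K (W i)) → S = ∅ := by
    intro S hS
    refine indep_of_parity_certificate (fun i => algebraMap (𝓞 K) K (W i)) (bitR2 G ccr) ?_ hcert S hS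
    intro k S' hS'
    have hS'' : IsSquare (∏ i ∈ S', W i) := isSquare_prod_of_isSquare_prod_coe _ hS'
    have hreal : ∀ kk : Fin 3,
        Even (S'.filter fun i => sgAt2 ccr (fm.get i) kk = true).card := fun kk => by
      have h := even_card_of_isSquare_real (ρ kk) (fun i => algebraMap (𝓞 K) K (W i)) (fun i => hρ0 kk i) hS'
      convert h using 2
      exact Finset.filter_congr (fun i _ => hsg kk i)
    obtain ⟨k, hk⟩ := k
    rcases k with _ | _ | _ | _ | _ | k
    · simpa [bitR2, bitRowR2, sgAt2] using hreal 0
    · simpa [bitR2, bitRowR2, sgAt2] using hreal 1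
    · simpa [bitR2, bitRowR2, sgAt2] using hreal 2
    · exact even_card_of_isSquare_valuation (G.toE2.fe.base.W₁r hθ h3 hR hprb) W hW0 _
        (fun i => by
          show ((!decide ((2 : ℤ) ∣ famL₁2 (fm.get i))) = true ↔ _)
          rw [log_W₁_of_famCheckE2 hθ h3 hE hK hpr (hfam1 i)]; simp) hS'
    · exact even_card_of_isSquare_valuation (G.toE2.fe.base.W₂r hθ h3 hR hprb) W hW0 _
        (fun i => by
          show ((!decide ((2 : ℤ) ∣ famL₂2 (fm.get i))) = true ↔ _)
          rw [log_W₂_of_famCheckE2 hθ h3 hE hK hpr (hfam1 i)]; simp) hS'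
    · have hk' : k < G.toE2.fe.base.chars.length := by omega
      have hch : G.toE2.fe.base.chars.getD k ((3 : ℕ), (0 : ℤ), (0 : ℤ)) ∈ G.toE2.fe.base.chars := by
        rw [List.getD_eq_getElem?_getD, List.getElem?_eq_getElem hk', Option.getD_some]
        exact List.getElem_mem hk'
      obtain ⟨h2', ψ, hψ⟩ := G.toE2.fe.base.exists_psi_of_reg hθ h3 hR hprb hch
      haveI : Fact (G.toE2.fe.base.chars.getD k (3, 0, 0)).1.Prime := ⟨G.toE2.fe.base.char_prime hprb hch⟩
      have hSX : IsSquare (∏ i ∈ S', lin hθ (fm.get i).X.1 (fm.get i).X.2.1 (fm.get i).X.2.2) := by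
        have e1 : ∀ i ∈ S', lin hθ (fm.get i).X.1 (fm.get i).X.2.1 (fm.get i).X.2.2 = (G.toE2.m₁ : 𝓞 K) * W i :=
          fun i _ => (m₁_mul_eltOf hθ hE hK (tv_of_famCheckE2 (hfam1 i))).symm
        rw [Finset.prod_congr rfl e1, Finset.prod_mul_distrib, Finset.prod_const]
        obtain ⟨z, hz⟩ := hS''
        refine ⟨(G.toE2.r₁ : 𝓞 K) ^ S'.card * z, ?_⟩
        rw [hz]
        simp only [ClFieldCertE2.m₁, Nat.cast_pow]
        ring
      have h := even_card_filter_eulerBit hθ (ℓ := (G.toE2.fe.base.chars.getD k (3, 0, 0)).1) (by omega) ψ hψ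
        (fun i => (fm.get i).X) (fun i => not_dvd_evalInt_of_famCheckE2 (hfam1 i) hch) hSX
      convert h using 2
      exact Finset.filter_congr (fun i _ => Iff.rfl)
  -- spanning of the `T`-units modulo squares
  have hodd : Odd (finrank ℚ K) := by rw [h3]; decide
  have hn : fm.length = NumberField.Units.rank K + 1 + (L + 2) := by
    rw [G.fre.re.units_rank_of_arch hθ h3 hR harch]
    simp only [hfm, fam2, List.length_append, List.length_map, hL, hhead]
    omega
  have hspan : ∀ u : K, u ≠ 0 →
      (∀ v : HeightOneSpectrum (𝓞 K),
        eltOf G.toE2 hθ hE ccr.cc.XD ccr.cc.YD * ((G.toE2.fe.base.q : ℕ) : 𝓞 K) ∉ v.asIdeal → v.valuation K u = 1) →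
      ∃ U : Finset (Fin fm.length), IsSquare (u * ∏ j ∈ U, algebraMap (𝓞 K) K (W j)) :=
    fun u hu huT => exists_isSquare_tunit_mul_prod hodd _ Tf hT hn (fun j => algebraMap (𝓞 K) K (W j))
      (fun j => RingOfIntegers.coe_ne_zero_iff.mpr (hW0 j)) hWval hind u hu huT
  -- the sieve is sound at rational points
  have hθQ : ∀ x : ℚ, algebraMap ℚ K x ≠ algebraMap (𝓞 K) K (eltOf G.toE2 hθ hE ccr.cc.Xt ccr.cc.Yt) :=
    ne_of_powIndep (powIndep_algebraMap hirrF' haev h3)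
  have hFrel : (eltOf G.toE2 hθ hE ccr.cc.Xt ccr.cc.Yt) ^ 3 + ccr.cc.A * (eltOf G.toE2 hθ hE ccr.cc.Xt ccr.cc.Yt) ^ 2 +
      ccr.cc.B * (eltOf G.toE2 hθ hE ccr.cc.Xt ccr.cc.Yt) + ccr.cc.C = 0 := by
    apply RingOfIntegers.coe_injective
    simpa only [map_add, map_mul, map_pow, map_intCast, _root_.map_zero] using MonicCubic.theta_rel haev
  -- the `θ_E`-order of the places, read on `X_t = m₁·e₀` (`m₁ > 0`)
  have hmR : (0 : ℝ) < G.toE2.m₁ := Nat.cast_pos.mpr (G.toE2.m₁_pos hK)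
  have h12 : ρ ccr.o₀ (algebraMap (𝓞 K) K (eltOf G.toE2 hθ hE ccr.cc.Xt ccr.cc.Yt)) <
      ρ ccr.o₁ (algebraMap (𝓞 K) K (eltOf G.toE2 hθ hE ccr.cc.Xt ccr.cc.Yt)) := by
    have h := lin_lt_lin hθ (ρ ccr.o₀) (ρ ccr.o₁) (h0 _) (hρ _).1 (hρ _).2 (h0 _) (hρ _).1 (hρ _).2 _ _ _
      (of_decide_eq_true hord.1)
    rw [rho_eltOf hθ hE hK htvX (ρ ccr.o₀), rho_eltOf hθ hE hK htvX (ρ ccr.o₁)] at h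
    exact lt_of_mul_lt_mul_left h hmR.le
  have h23 : ρ ccr.o₁ (algebraMap (𝓞 K) K (eltOf G.toE2 hθ hE ccr.cc.Xt ccr.cc.Yt)) <
      ρ ccr.o₂ (algebraMap (𝓞 K) K (eltOf G.toE2 hθ hE ccr.cc.Xt ccr.cc.Yt)) := by
    have h := lin_lt_lin hθ (ρ ccr.o₁) (ρ ccr.o₂) (h0 _) (hρ _).1 (hρ _).2 (h0 _) (hρ _).1 (hρ _).2 _ _ _
      (of_decide_eq_true hord.2)
    rw [rho_eltOf hθ hE hK htvX (ρ ccr.o₁), rho_eltOf hθ hE hK htvX (ρ ccr.o₂)] at h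
    exact lt_of_mul_lt_mul_left h hmR.le
  have hadm0 : admR2 G ccr ∅ ∅ = true := by
    simp only [admR2, Bool.and_eq_true, decide_eq_true_eq, Finset.filter_empty, Finset.card_empty]
    exact ⟨⟨admStd3RQ_empty _ hQ _ _ _ _ _ _ _ _, by decide⟩, by decide⟩
  have hadm : ∀ x y : ℚ, y ^ 2 = x ^ 3 + ccr.cc.A * x ^ 2 + ccr.cc.B * x + ccr.cc.C →
      ∀ (T : Finset (Fin 0)) (U : Finset (Fin fm.length)),
        IsSquare ((algebraMap ℚ K x - algebraMap (𝓞 K) K (eltOf G.toE2 hθ hE ccr.cc.Xt ccr.cc.Yt)) *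
          (∏ i ∈ T, algebraMap (𝓞 K) K (((fun i : Fin 0 => i.elim0 : Fin 0 → (𝓞 K)ˣ) i : (𝓞 K)ˣ) : 𝓞 K)) *
            ∏ j ∈ U, algebraMap (𝓞 K) K (W j)) → admR2 G ccr T U = true := by
    intro x y hxy T U hsq
    have h1 : admStd3R (fun i : Fin 0 => i.elim0) (famNorm2 G.toE2 ccr.cc) (fun i : Fin 0 => i.elim0)
        (fun i : Fin 0 => i.elim0) (fun i : Fin 0 => i.elim0) (fun j => sgAt2 ccr (fm.get j) ccr.o₀)
        (fun j => sgAt2 ccr (fm.get j) ccr.o₁) (fun j => sgAt2 ccr (fm.get j) ccr.o₂) T U = true :=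
      admStd3R_sound hirrF' haev h3 (ρ ccr.o₀) (ρ ccr.o₁) (ρ ccr.o₂) h12 h23
        (w := fun i : Fin 0 => algebraMap (𝓞 K) K
          (((fun i : Fin 0 => i.elim0 : Fin 0 → (𝓞 K)ˣ) i : (𝓞 K)ˣ) : 𝓞 K))
        (g := fun j => algebraMap (𝓞 K) K (W j)) (fun i => i.elim0)
        (fun j => RingOfIntegers.coe_ne_zero_iff.mpr (hW0 j)) (fun i => i.elim0)
        (fun j => norm_eltOf hθ h3 hE hK (tv_of_famCheckE2 (hfam1 j)) (dvd_of_famCheckE2 (hfam1 j)))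
        (fun i => i.elim0) (fun i => i.elim0) (fun i => i.elim0)
        (fun j => hsg _ j) (fun j => hsg _ j) (fun j => hsg _ j) x y hxy T U hsq
    have h2'' := valRow_sound hFrel hθQ (G.toE2.fe.base.W₁r hθ h3 hR hprb) (by rw [hderiv]; exact hDW₁) hW0
      (r := fun j => bitRowR2 ccr G.toE2.fe.base (fm.get j) 3) (fun j => by
        show ((!decide ((2 : ℤ) ∣ famL₁2 (fm.get j))) = true ↔ _)
        rw [show algebraMap (𝓞 K) K (W j) = ((W j : 𝓞 K) : K) from rfl,
          log_W₁_of_famCheckE2 hθ h3 hE hK hpr (hfam1 j)]; simp) x y hxy T U hsq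
    have h3'' := valRow_sound hFrel hθQ (G.toE2.fe.base.W₂r hθ h3 hR hprb) (by rw [hderiv]; exact hDW₂) hW0
      (r := fun j => bitRowR2 ccr G.toE2.fe.base (fm.get j) 4) (fun j => by
        show ((!decide ((2 : ℤ) ∣ famL₂2 (fm.get j))) = true ↔ _)
        rw [show algebraMap (𝓞 K) K (W j) = ((W j : 𝓞 K) : K) from rfl,
          log_W₂_of_famCheckE2 hθ h3 hE hK hpr (hfam1 j)]; simp) x y hxy T U hsq
    simp only [admR2, Bool.and_eq_true]
    exact ⟨⟨admStd3RQ_of_admStd3R hQ h1, h2''⟩, h3''⟩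
  -- the killed classes: rescale by the square `m₁ ^ (#U + 1) = (r₁ ^ (#U + 1))²`, then `admKills_sound` on
  -- `(m₁ x − X_t(θ)) · ∏_{j ∈ U} X_j(θ)` over the `X`-coordinates of the family (no separate units)
  have hkill := killListCheck_of_searchE2 hlite hk
  have hadmK : ∀ x y : ℚ, y ^ 2 = x ^ 3 + ccr.cc.A * x ^ 2 + ccr.cc.B * x + ccr.cc.C →
      ∀ (T : Finset (Fin 0)) (U : Finset (Fin fm.length)),
        IsSquare ((algebraMap ℚ K x - algebraMap (𝓞 K) K (eltOf G.toE2 hθ hE ccr.cc.Xt ccr.cc.Yt)) *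
          (∏ i ∈ T, algebraMap (𝓞 K) K (((fun i : Fin 0 => i.elim0 : Fin 0 → (𝓞 K)ˣ) i : (𝓞 K)ˣ) : 𝓞 K)) *
            ∏ j ∈ U, algebraMap (𝓞 K) K (W j)) → admR2K G ccr ks T U = true := by
    intro x y hxy T U hsq
    have hsq' : IsSquare ((algebraMap ℚ K ((G.toE2.m₁ : ℚ) * x) -
        algebraMap (𝓞 K) K (lin hθ ccr.cc.Xt.1 ccr.cc.Xt.2.1 ccr.cc.Xt.2.2)) *
          (∏ i ∈ T, algebraMap (𝓞 K) K (((fun i : Fin 0 => i.elim0 : Fin 0 → (𝓞 K)ˣ) i : (𝓞 K)ˣ) : 𝓞 K)) *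
            ∏ j ∈ U, algebraMap (𝓞 K) K (lin hθ (fm.get j).X.1 (fm.get j).X.2.1 (fm.get j).X.2.2)) := by
      have e0 : algebraMap ℚ K ((G.toE2.m₁ : ℚ) * x) - algebraMap (𝓞 K) K (lin hθ ccr.cc.Xt.1 ccr.cc.Xt.2.1 ccr.cc.Xt.2.2) =
          (G.toE2.m₁ : K) * (algebraMap ℚ K x - algebraMap (𝓞 K) K (eltOf G.toE2 hθ hE ccr.cc.Xt ccr.cc.Yt)) := by
        rw [mul_sub, hXe, map_mul, map_natCast]
      have e1 : ∀ j ∈ U, algebraMap (𝓞 K) K (lin hθ (fm.get j).X.1 (fm.get j).X.2.1 (fm.get j).X.2.2) =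
          (G.toE2.m₁ : K) * algebraMap (𝓞 K) K (W j) :=
        fun j _ => (m₁_mul_eltOf_coe hθ hE hK (tv_of_famCheckE2 (hfam1 j))).symm
      rw [e0, Finset.prod_congr rfl e1, Finset.prod_mul_distrib, Finset.prod_const]
      obtain ⟨w, hw⟩ := hsq
      have hm : (G.toE2.m₁ : K) * (G.toE2.m₁ : K) ^ U.card = ((G.toE2.r₁ : K) ^ (U.card + 1)) ^ 2 := by
        rw [← pow_succ', ClFieldCertE2.m₁, Nat.cast_pow, ← pow_mul, ← pow_mul, Nat.mul_comm]
      refine ⟨(G.toE2.r₁ : K) ^ (U.card + 1) * w, ?_⟩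
      calc (G.toE2.m₁ : K) * (algebraMap ℚ K x - algebraMap (𝓞 K) K (eltOf G.toE2 hθ hE ccr.cc.Xt ccr.cc.Yt)) *
            (∏ i ∈ T, algebraMap (𝓞 K) K (((fun i : Fin 0 => i.elim0 : Fin 0 → (𝓞 K)ˣ) i : (𝓞 K)ˣ) : 𝓞 K)) *
              ((G.toE2.m₁ : K) ^ U.card * ∏ j ∈ U, algebraMap (𝓞 K) K (W j))
          = ((G.toE2.m₁ : K) * (G.toE2.m₁ : K) ^ U.card) *
              ((algebraMap ℚ K x - algebraMap (𝓞 K) K (eltOf G.toE2 hθ hE ccr.cc.Xt ccr.cc.Yt)) *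
                (∏ i ∈ T, algebraMap (𝓞 K) K
                  (((fun i : Fin 0 => i.elim0 : Fin 0 → (𝓞 K)ˣ) i : (𝓞 K)ˣ) : 𝓞 K)) *
                  ∏ j ∈ U, algebraMap (𝓞 K) K (W j)) := by ring
        _ = ((G.toE2.r₁ : K) ^ (U.card + 1)) ^ 2 * (w * w) := by rw [hm, hw]
        _ = (G.toE2.r₁ : K) ^ (U.card + 1) * w * ((G.toE2.r₁ : K) ^ (U.card + 1) * w) := by ring
    exact admKills_sound hirr hθ h3 ccr.cc.Xt.1
      (u := fun i : Fin 0 => (((fun i : Fin 0 => i.elim0 : Fin 0 → (𝓞 K)ˣ) i : (𝓞 K)ˣ) : 𝓞 K))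
      (fun j => lin hθ (fm.get j).X.1 (fm.get j).X.2.1 (fm.get j).X.2.2)
      (cu := unitCoordsE2) (cg := famCoordsE2 ccr.cc) (fun i => i.elim0) (fun j => rfl) hkill
      (hadm x y hxy T U hsq) ((G.toE2.m₁ : ℚ) * x) hsq'
  exact mordellWeilRank_le_of_coverSet_cl_lt (A := ccr.cc.A) (B := ccr.cc.B) (C := ccr.cc.C)
    (⟨0, ccr.cc.A, 0, ccr.cc.B, ccr.cc.C⟩ : WeierstrassCurve ℚ) rfl rfl rfl rfl rfl hirrF' haev h3 hM0 hgen hDM hW0 hspan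
    (Wu := fun i : Fin 0 => i.elim0) (adm := admR2K G ccr ks)
    (admKills_empty hadm0 (noTrivial_of_liteE2 hlite)) hadmK (s' := r) hcount

/-- **`rank E(ℚ) = r`** (totally real two-view field) from the checked records and a tree lower bound.
[cite: CremonaAlgorithms1997, §3.6] -/
theorem rank_eq_of_checkE2RK (r : ℕ) (G : ClFieldCertRE2)
    (hθ : aeval θ (MonicCubic.poly G.toE2.fe.base.a G.toE2.fe.base.b G.toE2.fe.base.c) = 0)
    (h3 : finrank ℚ K = 3) (h2 : G.check2R = true) (hpr : G.toE2.fe.primeListE.Forall Nat.Prime)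
    (ccr : ClCurveCertE2R) (ks : List ClKillE2) (hc : checkE2RK G ccr r ks = true)
    (hk : killSearchE2 G.toE2 ccr.cc ks = true)
    (hlow : r ≤ (((⟨0, ccr.cc.A, 0, ccr.cc.B, ccr.cc.C⟩ : WeierstrassCurve ℤ)).map
      (Int.castRingHom ℚ)).mordellWeilRank) :
    (((⟨0, ccr.cc.A, 0, ccr.cc.B, ccr.cc.C⟩ : WeierstrassCurve ℤ)).map (Int.castRingHom ℚ)).mordellWeilRank =
      r := by
  have hV : ((⟨0, ccr.cc.A, 0, ccr.cc.B, ccr.cc.C⟩ : WeierstrassCurve ℤ)).map (Int.castRingHom ℚ) =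
      (⟨0, ccr.cc.A, 0, ccr.cc.B, ccr.cc.C⟩ : WeierstrassCurve ℚ) := by
    ext <;> simp [WeierstrassCurve.map]
  refine le_antisymm ?_ hlow
  rw [hV]
  exact rank_le_of_checkE2RK r G hθ h3 h2 hpr ccr ks hc hk

end Sound

end Summit.BirchSwinnertonDyer.BirchSwinnertonDyer.Rank2Observatory.TwoDescCl

end
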